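import Summits.AtomisticToContinuum.Crystallization.Theorems.PalmUnimodularRigidityLayeredLawsSelectHcpCertificateDefsD
import Summits.AtomisticToContinuum.Crystallization.Theorems.PalmUnimodularRigidityLayeredLawsSelectHcpLocalChartIff

/-!
# Crux `LayeredLawsSelectHcp` (stmt-AtomisticToContinuum-9226), line `mtp-prestress-split-ergodic-frame`:
# local charts on a graph ball are the restrictions of the rooted charts (R3′, lead c3)

Registered sub-goal `tube_localChart_iff_ball` of the crux item — the graph-ball version, for EVERY radius `n ≥ 1`, of the
landed near-ball statement `tube_localChart_iff` (`…LocalChartIff.lean`, the radius-`2` instance, there by kernel enumeration of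
the near ball).  A LOCAL CHART on the graph ball `ballLabels n` (`…CertificateDefsD.lean`) of a point set `S` is a labelling `z`
with `z 0 = 0`, ball values in `S`, injective on the ball, and ideal unit struts ↔ bonds (`0 < dist ≤ 28/25`) on the ball
(`IsLocalChartOn (ballLabels n) S z`).  For an hcp-charted `S ∋ 0` these are EXACTLY the restrictions to the ball of the rooted
labelled charts (`IsRootedChart`).  Pure combinatorics of the contact graph of the ideal hcp `Pᵢ = hcpSite 1 √(2/3)`, with NO
enumeration — a structural induction on the radius:

* `LocalChartIffBall.aut_star_step_on`: the local step `RootedChartUnique.aut_star_step` for an index map `σ` known only ON A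
  LABEL SET `B` (injective there, unit struts preserved in both directions there): if `w ∈ B` touches `v`, the star of `w` lies
  in `B`, and `σ` fixes `v`, `w` and the star of `v`, then `σ` fixes the star of `w` (the induced relabelling of the star of `w`
  is a touching-preserving injection of `hcpStarIdx`, hence an isometry of the ideal star, `stub_localCongruenceStarAut`, fixing
  the label of `v` and the labels of the common neighbours of `v` and `w`, hence the identity, `star_eq_of_profile`);
* `LocalChartIffBall.eqOn_ballLabels_of_fix_star`: so an index map injective and strut-preserving on `ballLabels n` which fixes
  the root and the twelve star labels is the identity on `ballLabels n` — by induction on `m` (`m + 1 ≤ n`), every label of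
  `ballLabels m` is fixed TOGETHER WITH ITS STAR: a new label of `ballLabels (m + 1)` is `w = nbr v ε₀` with `v ∈ ballLabels m`,
  fixed with `v` and the star of `v`, and the star of `w` lies in `ballLabels (m + 2) ⊆ ballLabels n`;
* `LocalChartIffBall.localChartOn_eqOn_ballLabels`: a local chart `z` on `ballLabels n` and a rooted chart `X` agreeing on the
  star agree on the ball (`σ = X⁻¹ ∘ z` is such an index map);
* `tube_localChart_iff_ball` (→): for a local chart `z` and a rooted chart `X₀` (`tube_exists_rootedChart`) the index map
  `X₀⁻¹ ∘ z` restricted to the star is an automorphism of the contact graph of the star (`autCands_complete`), i.e. the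
  restriction of one of the twelve index automorphisms `A t` (`exists_hcpIndexAut`); `X₀ ∘ A t` is a rooted chart agreeing with
  `z` on the star, hence on the ball.  (←): restriction of a rooted chart, injectivity by `RootedChartUnique.chart_injective`.

Also recorded here: re-rooting composes — `reRoot (reRoot X c₁) c₂ = reRoot X (labelShift c₁ c₂)` (`labelShift_labelShift`,
four parity cases), so a transport along a label path is ONE re-rooting; and the radius-`2` ball is the near ball
(`ballLabels_two`, by `decide`), so `IsLocalChart` is `IsLocalChartOn (ballLabels 2)`.

All `[folklore]`.
-/

noncomputable section

namespace Summit.AtomisticToContinuum.Crystallization.Theorems.PalmUnimodularRigidity.LayeredLawsSelectHcp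

open MeasureTheory Set
open Literature.MathematicalPhysics.StatisticalMechanics Literature.Geometry.DiscreteGeometry

/-! ## Re-rooting composes -/

/-- **Label transports compose**: transporting by `c₂` and then by `c₁` is transporting by the transported label
`labelShift c₁ c₂` (four parity cases). [folklore] -/
theorem labelShift_labelShift (c₁ c₂ u : ℤ × ℤ × ℤ) :
    labelShift c₁ (labelShift c₂ u) = labelShift (labelShift c₁ c₂) u := by
  obtain ⟨k₁, i₁, j₁⟩ := c₁
  obtain ⟨k₂, i₂, j₂⟩ := c₂
  obtain ⟨k, i, j⟩ := u
  simp only [labelShift, Int.even_iff, Prod.mk_add_mk, Prod.mk_sub_mk]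
  split_ifs <;> simp only [Prod.mk_add_mk, Prod.mk_sub_mk, Prod.mk.injEq] <;> omega

/-- **Re-rooting composes**: the chart re-rooted at `c₁` and then at `c₂` is the chart re-rooted at `labelShift c₁ c₂`.
[folklore] -/
theorem reRoot_reRoot (X : ℤ × ℤ × ℤ → EuclideanSpace ℝ (Fin 3)) (c₁ c₂ : ℤ × ℤ × ℤ) :
    reRoot (reRoot X c₁) c₂ = reRoot X (labelShift c₁ c₂) := by
  funext u
  simp only [reRoot, labelShift_labelShift, sub_sub_sub_cancel_right]

/-! ## The ball of radius two is the near ball -/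

/-- **The graph ball of radius `2` is the near ball** `{0} ∪ nearLabels` of `…CertificateDefs(B)` (by `decide`). [folklore] -/
theorem ballLabels_two : ballLabels 2 = nearBall := by
  decide +kernel

/-- A local chart on the near ball is a local chart on the graph ball of radius `2`. [folklore] -/
theorem isLocalChartOn_two_iff (S : Set (EuclideanSpace ℝ (Fin 3))) (z : ℤ × ℤ × ℤ → EuclideanSpace ℝ (Fin 3)) :
    IsLocalChartOn (ballLabels 2) S z ↔ IsLocalChart S z := by
  rw [ballLabels_two]
  rfl

namespace LocalChartIffBall

open RootedChartUnique LocalChartIff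

/-! ## Graph balls: unfolding and monotonicity -/

/-- The ball of radius `0` is the root. [folklore] -/
theorem ballLabels_zero : ballLabels 0 = {0} := rfl

/-- A label of the ball of radius `n + 1` is a label `v` of the ball of radius `n` or a labelled neighbour of one. [folklore] -/
theorem exists_of_mem_ballLabels_succ {n : ℕ} {u : ℤ × ℤ × ℤ} (hu : u ∈ ballLabels (n + 1)) :
    ∃ v ∈ ballLabels n, v = u ∨ ∃ ε ∈ hcpStarIdx, nbr v ε = u := by
  rw [ballLabels, Finset.mem_biUnion] at hu
  obtain ⟨v, hv, huv⟩ := hu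
  rw [Finset.mem_insert, Finset.mem_image] at huv
  rcases huv with rfl | ⟨ε, hε, rfl⟩
  · exact ⟨u, hv, Or.inl rfl⟩
  · exact ⟨v, hv, Or.inr ⟨ε, hε, rfl⟩⟩

/-- The graph balls increase with the radius. [folklore] -/
theorem ballLabels_subset {m n : ℕ} (h : m ≤ n) : ballLabels m ⊆ ballLabels n := by
  induction h with
  | refl => exact Finset.Subset.refl _
  | step _ ih => exact ih.trans (ballLabels_mono _)

/-- The star labels are labels of every ball of positive radius. [folklore] -/
theorem mem_ballLabels_of_mem_hcpStarIdx {n : ℕ} (hn : 1 ≤ n) {v : ℤ × ℤ × ℤ} (hv : v ∈ hcpStarIdx) :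
    v ∈ ballLabels n := by
  have h1 : nbr 0 v ∈ ballLabels 1 := nbr_mem_ballLabels_succ 0 0 (zero_mem_ballLabels 0) v hv
  rw [nbr_zero] at h1
  exact ballLabels_subset hn h1

/-! ## The local step on a label set -/

/-- **The local step on a label set `B`.**  If `σ : ℤ³ → ℤ³` is injective on `B` and preserves the ideal unit struts in both
directions on `B`, `w ∈ B` touches `v`, the twelve neighbours of `w` lie in `B`, and `σ` fixes `v`, `w` and the twelve
neighbours of `v`, then `σ` fixes the twelve neighbours of `w`: the induced relabelling of the star of `w` is a
touching-preserving injection of `hcpStarIdx`, hence an isometry of the ideal star (`stub_localCongruenceStarAut`), fixing the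
label of `v` and the labels touching it (common neighbours of `v` and `w`), hence the identity (`star_eq_of_profile`)
(cf. `RootedChartUnique.aut_star_step`, `LocalChartIff.aut_star_step_local`). [folklore] -/
theorem aut_star_step_on {B : Finset (ℤ × ℤ × ℤ)} {σ : ℤ × ℤ × ℤ → ℤ × ℤ × ℤ}
    (hσ : ∀ u ∈ B, ∀ z ∈ B,
      (dist (hcpSite 1 (Real.sqrt (2 / 3)) (σ u)) (hcpSite 1 (Real.sqrt (2 / 3)) (σ z)) = 1 ↔
        dist (hcpSite 1 (Real.sqrt (2 / 3)) u) (hcpSite 1 (Real.sqrt (2 / 3)) z) = 1))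
    (hinj : Set.InjOn σ ↑B) {v w : ℤ × ℤ × ℤ}
    (hvw : dist (hcpSite 1 (Real.sqrt (2 / 3)) v) (hcpSite 1 (Real.sqrt (2 / 3)) w) = 1) (hwB : w ∈ B)
    (hNB : ∀ γ ∈ hcpStarIdx, nbr w γ ∈ B) (hv : σ v = v) (hw : σ w = w)
    (hN : ∀ ε ∈ hcpStarIdx, σ (nbr v ε) = nbr v ε) : ∀ γ ∈ hcpStarIdx, σ (nbr w γ) = nbr w γ := by
  -- the induced relabelling of the star of `w`
  have hex : ∀ γ ∈ hcpStarIdx, ∃ δ ∈ hcpStarIdx, σ (nbr w γ) = nbr w δ := fun γ hγ => by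
    have h1 : dist (hcpSite 1 (Real.sqrt (2 / 3)) w) (hcpSite 1 (Real.sqrt (2 / 3)) (nbr w γ)) = 1 :=
      (dist_ideal_eq_one_iff_nbr w _).2 ⟨γ, hγ, rfl⟩
    have h2 := (hσ w hwB (nbr w γ) (hNB γ hγ)).2 h1
    rw [hw] at h2
    exact (dist_ideal_eq_one_iff_nbr w _).1 h2
  choose! π hπmem hπeq using hex
  have hπinj : Set.InjOn π ↑hcpStarIdx := fun γ hγ γ' hγ' hγγ' =>
    nbr_label_cancel (hinj (hNB γ hγ) (hNB γ' hγ') (by rw [hπeq γ hγ, hπeq γ' hγ', hγγ']))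
  have hπmaps : Set.MapsTo π ↑hcpStarIdx ↑hcpStarIdx := fun γ hγ => hπmem γ hγ
  have hπadj : ∀ γ ∈ hcpStarIdx, ∀ γ' ∈ hcpStarIdx,
      (dist (hcpSite 1 (Real.sqrt (2 / 3)) (π γ)) (hcpSite 1 (Real.sqrt (2 / 3)) (π γ')) = 1 ↔
        dist (hcpSite 1 (Real.sqrt (2 / 3)) γ) (hcpSite 1 (Real.sqrt (2 / 3)) γ') = 1) := by
    intro γ hγ γ' hγ'
    rw [← dist_nbr_nbr w (π γ) (π γ'), ← hπeq γ hγ, ← hπeq γ' hγ', hσ _ (hNB γ hγ) _ (hNB γ' hγ'),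
      dist_nbr_nbr]
  have hiso := stub_localCongruenceStarAut 1 (Real.sqrt (2 / 3)) π hπinj hπmaps hπadj
  -- the label of `v` in the star of `w` and the labels touching it are fixed
  obtain ⟨γᵥ, hγᵥ, hvγ⟩ := (dist_ideal_eq_one_iff_nbr w v).1 (by rw [dist_comm]; exact hvw)
  have hfix : ∀ l ∈ hcpStarIdx, σ (nbr w l) = nbr w l → π l = l := fun l hl hl' =>
    nbr_label_cancel (by rw [← hπeq l hl, hl'])
  have hfixv : π γᵥ = γᵥ := hfix γᵥ hγᵥ (by rw [← hvγ, hv])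
  have hfixN : ∀ l ∈ hcpStarIdx,
      dist (hcpSite 1 (Real.sqrt (2 / 3)) γᵥ) (hcpSite 1 (Real.sqrt (2 / 3)) l) = 1 → π l = l := by
    intro l hl hdl
    refine hfix l hl ?_
    have h1 : dist (hcpSite 1 (Real.sqrt (2 / 3)) v) (hcpSite 1 (Real.sqrt (2 / 3)) (nbr w l)) = 1 := by
      rw [hvγ, dist_nbr_nbr]; exact hdl
    obtain ⟨δ, hδ, hδe⟩ := (dist_ideal_eq_one_iff_nbr v _).1 h1
    rw [hδe]
    exact hN δ hδ
  -- so the relabelling is the identity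
  intro γ hγ
  rw [hπeq γ hγ]
  congr 1
  refine star_eq_of_profile hγᵥ (hπmem γ hγ) hγ ?_ fun l hl hdl => ?_
  · have := (hiso γ hγ γᵥ hγᵥ).1
    rwa [hfixv] at this
  · have := (hiso γ hγ l hl).1
    rwa [hfixN l hl hdl] at this

/-! ## Index maps on a graph ball fixing the root star are the identity there -/

/-- **An index map injective and strut-preserving on the graph ball of radius `n ≥ 1` which fixes the root and the star labels is
the identity on that ball.**  Structural induction on the radius: every label of `ballLabels m` is fixed together with its twelve
neighbours (`m + 1 ≤ n`) — for `m = 0` this is the hypothesis (`nbr 0 ε = ε`), and a new label `nbr v ε₀` of `ballLabels (m + 1)`,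
`v ∈ ballLabels m`, is fixed with `v` and the star of `v`, so the local step at `w = nbr v ε₀` (whose star lies in
`ballLabels (m + 2) ⊆ ballLabels n`) fixes the star of `w`. [folklore] -/
theorem eqOn_ballLabels_of_fix_star {n : ℕ} (hn : 1 ≤ n) {σ : ℤ × ℤ × ℤ → ℤ × ℤ × ℤ}
    (hσ : ∀ u ∈ ballLabels n, ∀ z ∈ ballLabels n,
      (dist (hcpSite 1 (Real.sqrt (2 / 3)) (σ u)) (hcpSite 1 (Real.sqrt (2 / 3)) (σ z)) = 1 ↔
        dist (hcpSite 1 (Real.sqrt (2 / 3)) u) (hcpSite 1 (Real.sqrt (2 / 3)) z) = 1))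
    (hinj : Set.InjOn σ ↑(ballLabels n)) (h0 : σ 0 = 0) (hN : ∀ ε ∈ hcpStarIdx, σ ε = ε) :
    ∀ u ∈ ballLabels n, σ u = u := by
  -- every label of the ball of radius `m` is fixed together with its twelve neighbours (`m + 1 ≤ n`)
  have key : ∀ m : ℕ, m + 1 ≤ n → ∀ v ∈ ballLabels m, σ v = v ∧ ∀ ε ∈ hcpStarIdx, σ (nbr v ε) = nbr v ε := by
    intro m
    induction m with
    | zero =>
      intro _ v hv
      rw [ballLabels_zero, Finset.mem_singleton] at hv
      subst hv
      exact ⟨h0, fun ε hε => by rw [nbr_zero]; exact hN ε hε⟩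
    | succ m ih =>
      intro hm w hw
      obtain ⟨v, hv, hvw⟩ := exists_of_mem_ballLabels_succ hw
      have ihv := ih (by omega) v hv
      rcases hvw with rfl | ⟨ε₀, hε₀, rfl⟩
      · exact ihv
      · have hwfix : σ (nbr v ε₀) = nbr v ε₀ := ihv.2 ε₀ hε₀
        exact ⟨hwfix, aut_star_step_on hσ hinj ((dist_ideal_eq_one_iff_nbr v _).2 ⟨ε₀, hε₀, rfl⟩)
          (ballLabels_subset (by omega) hw)
          (fun γ hγ => ballLabels_subset hm (nbr_mem_ballLabels_succ _ _ hw γ hγ)) ihv.1 hwfix ihv.2⟩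
  intro u hu
  obtain ⟨k, rfl⟩ : ∃ k, n = k + 1 := ⟨n - 1, by omega⟩
  obtain ⟨v, hv, hvu⟩ := exists_of_mem_ballLabels_succ hu
  have hk := key k le_rfl v hv
  rcases hvu with rfl | ⟨ε, hε, rfl⟩
  · exact hk.1
  · exact hk.2 ε hε

/-- **A local chart on the graph ball of radius `n ≥ 1` and a rooted chart of the same carrier which agree on the twelve star
labels agree on the ball**: the index map `σ = X⁻¹ ∘ z` (charts are onto resp. into `S`, and injective) fixes the root and the
star labels, is injective on the ball and preserves the unit struts there. [folklore] -/
theorem localChartOn_eqOn_ballLabels {n : ℕ} (hn : 1 ≤ n) {S : Set (EuclideanSpace ℝ (Fin 3))}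
    {z X : ℤ × ℤ × ℤ → EuclideanSpace ℝ (Fin 3)} (hz : IsLocalChartOn (ballLabels n) S z) (hX : IsRootedChart S X)
    (hagree : ∀ v ∈ hcpStarIdx, z v = X v) : ∀ u ∈ ballLabels n, z u = X u := by
  obtain ⟨hz0, hzS, hzinj, hzb⟩ := hz
  obtain ⟨hX0, -, hSX, hXb⟩ := hX
  have hXinj : Function.Injective X := chart_injective hXb
  have hex : ∀ u ∈ ballLabels n, ∃ s, X s = z u := fun u hu => hSX _ (hzS u hu)
  choose! σ hσ using hex
  have hadj : ∀ u ∈ ballLabels n, ∀ w ∈ ballLabels n,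
      (dist (hcpSite 1 (Real.sqrt (2 / 3)) (σ u)) (hcpSite 1 (Real.sqrt (2 / 3)) (σ w)) = 1 ↔
        dist (hcpSite 1 (Real.sqrt (2 / 3)) u) (hcpSite 1 (Real.sqrt (2 / 3)) w) = 1) := fun u hu w hw => by
    rw [hXb, hσ u hu, hσ w hw, hzb u hu w hw]
  have hinj : Set.InjOn σ ↑(ballLabels n) := fun u hu w hw huw =>
    hzinj hu hw (by rw [← hσ u hu, ← hσ w hw]; exact congrArg X huw)
  have h0 : σ 0 = 0 := hXinj (by rw [hσ 0 (zero_mem_ballLabels n), hz0, hX0])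
  have hN : ∀ ε ∈ hcpStarIdx, σ ε = ε := fun ε hε =>
    hXinj (by rw [hσ ε (mem_ballLabels_of_mem_hcpStarIdx hn hε), hagree ε hε])
  intro u hu
  rw [← hσ u hu, eqOn_ballLabels_of_fix_star hn hadj hinj h0 hN u hu]

end LocalChartIffBall

open RootedChartUnique LocalChartIff LocalChartIffBall in
/-- **Registered sub-goal `tube_localChart_iff_ball` (R3′) — local charts on the graph ball of radius `n ≥ 1` are exactly the
restrictions of the rooted charts.**  For an hcp-charted `S ∋ 0`, `z` is a local chart on `ballLabels n` (`IsLocalChartOn`) iff `z`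
agrees on `ballLabels n` with some rooted labelled chart `X` of `S`.  (→): with a rooted chart `X₀` (`tube_exists_rootedChart`) the
index map `X₀⁻¹ ∘ z` is, on the star, an automorphism of the contact graph of the star, i.e. the restriction of an index
automorphism `A t` (`exists_hcpIndexAut`, `autCands_complete`); `X₀ ∘ A t` is a rooted chart agreeing with `z` on the star, hence
on the ball (`localChartOn_eqOn_ballLabels`, a structural induction on the radius).  (←): immediate, injectivity by
`chart_injective`. [folklore] -/
theorem tube_localChart_iff_ball : ∀ (n : ℕ), 1 ≤ n → ∀ S : Set (EuclideanSpace ℝ (Fin 3)), (0 : EuclideanSpace ℝ (Fin 3)) ∈ S → HcpCharted S → ∀ z : ℤ × ℤ × ℤ → EuclideanSpace ℝ (Fin 3), IsLocalChartOn (ballLabels n) S z ↔ ∃ X : ℤ × ℤ × ℤ → EuclideanSpace ℝ (Fin 3), IsRootedChart S X ∧ ∀ u ∈ ballLabels n, z u = X u := by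
  intro n hn S h0 hchart z
  constructor
  · intro hz
    obtain ⟨hz0, hzS, hzinj, hzb⟩ := id hz
    obtain ⟨X₀, hX0, hXS, hSX, hXc⟩ := tube_exists_rootedChart S h0 hchart
    have hinj : Function.Injective X₀ := chart_injective hXc
    obtain ⟨A, hA0, hAsurj, hAQ, -, hAB⟩ := exists_hcpIndexAut
    have hAaut : ∀ g ∈ autCands 12, ∃ t, ∀ m : Fin 12, starLab (g m) = A t (starLab m) := fun g hg => by
      simp only [List.all_eq_true, List.any_eq_true, decide_eq_true_eq] at hAB
      obtain ⟨t, -, ht⟩ := hAB g hg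
      exact ⟨t, fun m => ht m (mem_allLab m)⟩
    have hAadj : ∀ t u w,
        (dist (hcpSite 1 (Real.sqrt (2 / 3)) (A t u)) (hcpSite 1 (Real.sqrt (2 / 3)) (A t w)) = 1 ↔
          dist (hcpSite 1 (Real.sqrt (2 / 3)) u) (hcpSite 1 (Real.sqrt (2 / 3)) w) = 1) := fun t u w => by
      rw [dist_ideal_eq_one_iff, dist_ideal_eq_one_iff, hAQ]
    -- the index map `X₀⁻¹ ∘ z` on the ball
    have hex : ∀ u ∈ ballLabels n, ∃ s, X₀ s = z u := fun u hu => hSX _ (hzS u hu)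
    choose! σ hσ using hex
    have hσadj : ∀ u ∈ ballLabels n, ∀ w ∈ ballLabels n,
        (dist (hcpSite 1 (Real.sqrt (2 / 3)) (σ u)) (hcpSite 1 (Real.sqrt (2 / 3)) (σ w)) = 1 ↔
          dist (hcpSite 1 (Real.sqrt (2 / 3)) u) (hcpSite 1 (Real.sqrt (2 / 3)) w) = 1) := fun u hu w hw => by
      rw [hXc, hσ u hu, hσ w hw, hzb u hu w hw]
    have hσinj : Set.InjOn σ ↑(ballLabels n) := fun u hu w hw huw =>
      hzinj hu hw (by rw [← hσ u hu, ← hσ w hw]; exact congrArg X₀ huw)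
    have hσ0 : σ 0 = 0 := hinj (by rw [hσ 0 (zero_mem_ballLabels n), hz0, hX0])
    -- on the star it is an automorphism of the contact graph of the star
    have hmaps : ∀ δ ∈ hcpStarIdx, σ δ ∈ hcpStarIdx := fun δ hδ => by
      have hδN : δ ∈ ballLabels n := mem_ballLabels_of_mem_hcpStarIdx hn hδ
      rw [mem_hcpStarIdx_iff_dist] at hδ ⊢
      rw [← hσ0, hσadj 0 (zero_mem_ballLabels n) δ hδN]
      exact hδ
    have hex' : ∀ m : Fin 12, ∃ n : Fin 12, starLab n = σ (starLab m) := fun m =>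
      exists_starLab_eq (hmaps _ (starLab_mem m))
    choose f hf using hex'
    have hfinj : Function.Injective f := fun m m' hmm' =>
      starLab_injective (hσinj (mem_ballLabels_of_mem_hcpStarIdx hn (starLab_mem m))
        (mem_ballLabels_of_mem_hcpStarIdx hn (starLab_mem m')) (by rw [← hf m, ← hf m', hmm']))
    have hfadj : ∀ m n, starAdjT (f m) (f n) = starAdjT m n := fun m m' => by
      have key := hσadj (starLab m) (mem_ballLabels_of_mem_hcpStarIdx hn (starLab_mem m)) (starLab m')
        (mem_ballLabels_of_mem_hcpStarIdx hn (starLab_mem m'))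
      rw [← hf m, ← hf m', dist_ideal_eq_one_iff, dist_ideal_eq_one_iff] at key
      rw [starAdjT_spec, starAdjT_spec, decide_eq_decide]
      exact key
    obtain ⟨g, hg, hgf⟩ := autCands_complete hfinj hfadj 12
    obtain ⟨t, ht⟩ := hAaut g hg
    -- the rooted chart `X₀ ∘ A t` agrees with `z` on the star
    have hXR : IsRootedChart S fun u => X₀ (A t u) :=
      ⟨by show X₀ (A t 0) = 0; rw [hA0, hX0], fun u => hXS _, fun y hy => by
        obtain ⟨u, rfl⟩ := hSX y hy
        obtain ⟨u', rfl⟩ := hAsurj t u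
        exact ⟨u', rfl⟩,
       fun u w => by rw [← hAadj t]; exact hXc _ _⟩
    refine ⟨fun u => X₀ (A t u), hXR, localChartOn_eqOn_ballLabels hn hz hXR fun v hv => ?_⟩
    obtain ⟨m, rfl⟩ := exists_starLab_eq hv
    show z (starLab m) = X₀ (A t (starLab m))
    rw [← ht m, hgf m m.2, hf m, hσ _ (mem_ballLabels_of_mem_hcpStarIdx hn (starLab_mem m))]
  · rintro ⟨X, ⟨hX0, hXS, -, hXb⟩, hzX⟩
    refine ⟨by rw [hzX 0 (zero_mem_ballLabels n), hX0], fun u hu => by rw [hzX u hu]; exact hXS u,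
      fun u hu w hw huw => ?_, fun u hu w hw => by rw [hzX u hu, hzX w hw]; exact hXb u w⟩
    rw [hzX u hu, hzX w hw] at huw
    exact chart_injective hXb huw

end Summit.AtomisticToContinuum.Crystallization.Theorems.PalmUnimodularRigidity.LayeredLawsSelectHcp

end
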